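import Summits.ResolutionOfSingularities.ResolutionOfSingularities.Theorems.FrobeniusLadderFInjectiveMacaulayficationPencilPhiPrime
import Mathlib.RingTheory.Polynomial.UniqueFactorization
import HarnessLib

/-!
# TASK 4b: the `U`-chart equation `Φ_U = (y^{M₂}(y^r − y^s))⁺·U − (y^{M₁})⁺` of the pencil blow-up IS PRIME from the exponent data alone — the twin of ✓p697613
# `PencilPhiPrime.prime_pencilPhiW` that discharges the hypothesis `hΦp` of the pole theorems (✓p696598, ✓p697408, ✓p697883, ✓p699830 `…U_pole_code5/6`, code 3, transversal)
# (crux `FInjectiveMacaulayfication` stmt-ResolutionOfSingularities-15315, chain w45a; RULING R23.8 (3) «→ `Prime Φ_U` twin»; consumer res-L1-w45a-stub-3 TASK 4c; seat res-L1-w45a-stub-1 g15)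

[OURS · L1 W4.5a] Support file (`--supports stmt-ResolutionOfSingularities-15315 --as helper`); theorems only; unconditional; any field. Nothing of the crux is proved. AI-written
(AI review is weaker than expert review).

PROOF. ✓ `prime_pencilPhiAffine (M B)` wants `M ≠ 0` and «`B` regular modulo `M`». Here `M = y^{M₂}(y^r − y^s)`, `B = y^{M₁}`: in the UFD `k[y]` a prime common divisor of `M` and
`y^{M₁}` would be an associate of a variable `y_i` with `M₁ i ≠ 0`, but such a `y_i` divides neither `y^{M₂}` (`M₁ ⊥ M₂`) nor `y^r − y^s` (`r ⊥ s`, `r ≠ s`; ✓ `not_X_dvd_binomial`); so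
`M ∣ y^{M₁}·t ⇒ M ∣ t` (Mathlib `UniqueFactorizationMonoid.dvd_of_dvd_mul_right_of_no_prime_factors`).
* `binomial_ne_zero`, `not_X_dvd_pencilB`, `no_prime_factors_pencilB_monomial`, ★★ `prime_pencilPhiU`.
[folklore UFD bookkeeping; cite: Fedder1983, Thm. 1.12 (the criterion these charts feed)]
-/

set_option linter.dupNamespace false

noncomputable section

open MvPolynomial

namespace Summit.ResolutionOfSingularities.ResolutionOfSingularities.Theorems.FInjectiveMacaulayfication.PencilPhiPrimeU

open Summit.ResolutionOfSingularities.ResolutionOfSingularities.Theorems.FInjectiveMacaulayfication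
open PencilPhiPrime

variable (k : Type) [Field k] {n : ℕ}

/-- `y^r − y^s ≠ 0` for `r ≠ s`. [plumbing] -/
theorem binomial_ne_zero (r s : Fin n →₀ ℕ) (hne : r ≠ s) : (monomial r (1 : k) - monomial s 1 : MvPolynomial (Fin n) k) ≠ 0 := by
  classical
  intro h
  have := congrArg (coeff r) h
  rw [coeff_sub, coeff_monomial, coeff_monomial, if_pos rfl, if_neg (Ne.symm hne), sub_zero, coeff_zero] at this
  exact one_ne_zero this

/-- **No variable of `y^{M₁}` divides `y^{M₂}(y^r − y^s)`** (`M₁ ⊥ M₂`, `r ⊥ s`, `r ≠ s`). [folklore] -/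
theorem not_X_dvd_pencilB (M₁ M₂ r s : Fin n →₀ ℕ) (hdisj : ∀ i, M₁ i = 0 ∨ M₂ i = 0) (hrs : ∀ i, r i = 0 ∨ s i = 0) (hne : r ≠ s)
    (i : Fin n) (hi : M₁ i ≠ 0) : ¬ (X i : MvPolynomial (Fin n) k) ∣ monomial M₂ (1 : k) * (monomial r 1 - monomial s 1) := by
  intro h
  rcases (X_prime (R := k) (i := i)).dvd_or_dvd h with h1 | h1
  · rw [X_dvd_monomial] at h1
    rcases h1 with h1 | h1
    · exact one_ne_zero h1
    · exact h1 ((hdisj i).resolve_left hi)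
  · exact not_X_dvd_binomial k r s hne i (hrs i) h1

/-- **`y^{M₂}(y^r − y^s)` and `y^{M₁}` have no common prime factor.** [folklore UFD bookkeeping] -/
theorem no_prime_factors_pencilB_monomial (M₁ M₂ r s : Fin n →₀ ℕ) (hdisj : ∀ i, M₁ i = 0 ∨ M₂ i = 0) (hrs : ∀ i, r i = 0 ∨ s i = 0) (hne : r ≠ s)
    {d : MvPolynomial (Fin n) k} (hdM : d ∣ monomial M₂ (1 : k) * (monomial r 1 - monomial s 1)) (hdA : d ∣ monomial M₁ (1 : k)) : ¬ Prime d := by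
  classical
  intro hd
  rw [monomial_eq, C_1, one_mul, Finsupp.prod] at hdA
  obtain ⟨i, hi, hdi⟩ := hd.exists_mem_finset_dvd hdA
  have hdX : d ∣ (X i : MvPolynomial (Fin n) k) := hd.dvd_of_dvd_pow hdi
  have hass : Associated d (X i) := hd.irreducible.associated_of_dvd X_prime.irreducible hdX
  exact not_X_dvd_pencilB k M₁ M₂ r s hdisj hrs hne i (Finsupp.mem_support_iff.1 hi) (hass.dvd_iff_dvd_left.1 hdM)

/-- ★★ **`Φ_U = (y^{M₂}(y^r − y^s))⁺·X 0 − (y^{M₁})⁺` IS PRIME from the exponent data alone**: `M₁ ⊥ M₂`, `r ⊥ s`, `r ≠ s`. (Discharges `hΦp` of every pole theorem of TASK 4b.)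
[folklore; OURS] -/
theorem prime_pencilPhiU (M₁ M₂ r s : Fin n →₀ ℕ) (hdisj : ∀ i, M₁ i = 0 ∨ M₂ i = 0) (hrs : ∀ i, r i = 0 ∨ s i = 0) (hne : r ≠ s) :
    Prime (rename Fin.succ (monomial M₂ (1 : k) * (monomial r 1 - monomial s 1)) * X 0 - rename Fin.succ (monomial M₁ (1 : k)) : MvPolynomial (Fin (n + 1)) k) := by
  classical
  have hM : (monomial M₂ (1 : k) * (monomial r 1 - monomial s 1) : MvPolynomial (Fin n) k) ≠ 0 :=
    mul_ne_zero (by rw [Ne, monomial_eq_zero]; exact one_ne_zero) (binomial_ne_zero k r s hne)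
  refine prime_pencilPhiAffine k _ _ hM fun t ht => ?_
  rw [Ideal.mem_span_singleton] at ht ⊢
  exact UniqueFactorizationMonoid.dvd_of_dvd_mul_right_of_no_prime_factors hM
    (fun hdM hdA => no_prime_factors_pencilB_monomial k M₁ M₂ r s hdisj hrs hne hdM hdA) ht

end Summit.ResolutionOfSingularities.ResolutionOfSingularities.Theorems.FInjectiveMacaulayfication.PencilPhiPrimeU

end
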